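import Literature.NumberTheory.GelbartRogawski1991.ThetaTypeNonsplitJacquetModule          -- ★ N3 (raw; typ-T7a p826177): NAMED FACT `thetaType_nonsplit_jacquetModule`
import Literature.NumberTheory.GelbartRogawski1991.ThetaTypeNonsplitBorelEigenfunctional    -- ★ N3ᵟ (typ-T7a p826640): NAMED FACT `thetaType_nonsplit_borelEigenfunctional`
import Summits.HodgeConjecture.HodgeConjecture.Theorems.F0P2nJacquetFunctionalCurrency      -- ★ p01 (g6): `functional_proj_of_levi_unipotent`, `rootDeltaChar_cmBorel_eq_proj`
import Summits.HodgeConjecture.HodgeConjecture.Theorems.F0P2oBorelTorusModulus              -- ★ K1m (A-p12 (g16) p827378): `rootDeltaChar_cmBorel_torus` (`δ_B^{1/2}(d(α,β,ᾱ⁻¹)) = ‖α‖`)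
import Literature.NumberTheory.Automorphic.UnitaryGroupFormCongrFinSum                      -- ★ `formCongr_mul_eq`
import HarnessLib

/-!
# Crux `H413`, programme P2, pay-down line `F0_P2GR91NJacquet`, K1 sub-line — DEBT CONSOLIDATION «N3 ⟹ N3ᵟ»:
# the Borel eigenfunctional of the local theta type FROM its Jacquet module and the local torus modulus

Cell hodgecm-mathlib (D-0151), FLOOR 0, crux H413 = stmt-HodgeConjecture-24833; K1 sub-line `Cruxes/H413/Lines/F0_P2GR91NJacquetK1.lean`
(v3a 368644d96141), lead B-p18 (g28).  The K1aʷ stub is closed modulo the print letter ★ N3ᵟ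
`GelbartRogawski1991.thetaType_nonsplit_borelEigenfunctional` (p826640), which is the `δ_B^{1/2}`-CURRENCY TWIN of the raw letter ★ N3
`GelbartRogawski1991.thetaType_nonsplit_jacquetModule` (p826177; print's (3.2.1)–(3.2.2) as an honest torus action on the UNNORMALISED
Jacquet module).  This file proves the implication **N3 ⟹ N3ᵟ** in the kernel, using the LOCAL TORUS MODULUS K1m
`δ_B^{1/2}(d(α,β,ᾱ⁻¹)) = ‖α‖_E` of the Borel of `U(Φ₃)(L⁺_v)` (★ A-p12 (g16) p827378 `Theorems/F0P2oBorelTorusModulus.lean ::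
rootDeltaChar_cmBorel_torus`) — so the two GR91 local letters of the K1 line count as ONE (the sub-line's letter binder for K1aʷ can be
`stub_N3_letter : thetaType_nonsplit_jacquetModule` with `stub_K1aW_letter := thetaType_nonsplit_borelEigenfunctional_of_jacquetModule stub_N3_letter`).
THEOREMS ONLY; conditional on the named fact N3 (binder `hN3`), nothing else.
HC_CM is proved only modulo the printed citations until rung 0 closes; this file proves no letter.

## The mathematics (three moves, all bookkeeping)
1. (§1, generic) A representation `ρ` of `G`, a parabolic triple `(P, M, N)`, and a character `χ` of `M` by which `M` acts on the
   (unnormalised) Jacquet module `r_N(ρ)`: if `r_N(ρ) ≠ 0`, then `ℓ := λ ∘ [·]` (`λ` a linear form on `r_N(ρ)` non-zero on some class) is a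
   NON-ZERO functional on `ρ`, `N`-invariant and `(M, χ)`-equivariant. [cite: BernsteinZelevinsky1977, §1.8–1.9]
2. (§2) `χθ = χθʷ · δ_B^{1/2}` on the torus: `μ_v(α)‖α‖^{1/2}ψθ(β) = (μ_v(α)‖α‖^{-1/2}ψθ(β)) · ‖α‖` (★ `xiTorusChar_apply`) and `δ_B^{1/2}(d(α,β,ᾱ⁻¹)) = ‖α‖`
   (★ K1m `rootDeltaChar_cmBorel_torus`); then `p = m·n` by ★ `functional_proj_of_levi_unipotent` and `δ^{1/2}(proj p) = δ^{1/2}(p)` (★ `rootDeltaChar_cmBorel_eq_proj`).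
3. (§3) Transport of the telescope: N3 reads `X_v` on `U(Φ₃)(L⁺_v)` along a form congruence `T′` of `diag dV`, N3ᵟ along
   `κ_v⁻¹ ∘ localPiEquiv_H⁻¹ ∘ congr_T` for a form congruence `T` of `H` and the frame `g` (`ᵗḡ H g = diag dV`); with `T′ := g_v⁻¹ T` the two
   pull-backs are the SAME homomorphism `U(Φ₃)(L⁺_v) → U(diag dV)(L⁺_v)` (`g_v⁻¹ (T u T⁻¹) g_v = T′ u T′⁻¹`). [cite: PlatonovRapinchuk1994, §2.3]
Non-vanishing of `r_N(X_v)` is exactly the hypothesis `OccursInLineWeilCM` of N3ᵟ through N3 (a).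

## References
* [GelbartRogawski1991] Invent. Math. 105 (1991): §3.2 (3.2.1)–(3.2.3) p. 457; §1.4 pp. 450–451; §5.1 Lem. 5.1.2; §5.2 p. 467.
* [BernsteinZelevinsky1977] Ann. sci. ÉNS 10 (1977): §1.8–1.9 (Jacquet functor), 1.7 (`δ_P`).  [Kudla1986] Invent. Math. 83: Thm. 2.8.
* [PlatonovRapinchuk1994] §2.3 (change of basis).  [Rogawski1990] Ann. of Math. Stud. 123: §12.1 p. 172, §12.2 (2) p. 174.
-/

set_option autoImplicit false
-- the mandated namespace has the single-problem summit's repeated segment (`HodgeConjecture.HodgeConjecture`)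
set_option linter.dupNamespace false

noncomputable section

open NumberField IsDedekindDomain MeasureTheory
open scoped Matrix

open Literature.NumberTheory Literature.NumberTheory.Automorphic Literature.NumberTheory.Automorphic.UnitaryGroup
open Literature.NumberTheory.Automorphic.IdeleClassGroup
open Literature.NumberTheory.Automorphic.Liu2021 Literature.NumberTheory.Automorphic.Liu2021.Def411WeilCarriers
open Literature.NumberTheory.GaloisRepresentations
open Literature.NumberTheory.Rogawski1990
open Literature.NumberTheory.GelbartRogawski1991
open Literature.RepresentationTheory

namespace Summit.HodgeConjecture.HodgeConjecture.Cruxes.H413.F0P2oBorelEigenfunctionalOfJacquetModule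

/-! ## §1 Generic: a non-zero `(P, χ)`-eigenfunctional from a character on a non-zero Jacquet module -/

section Generic

variable {G V : Type*} [Group G] [AddCommGroup V] [Module ℂ V] (t : ParabolicTriple G)

/-- **A functional from the Jacquet module.**  If `M` acts on the (unnormalised) Jacquet module `r_N(ρ)` by the scalar `χ(m)` and
`r_N(ρ) ≠ 0`, then `ρ` carries a non-zero linear functional `ℓ`, invariant under `N` and transforming under `M` by `χ`:
`ℓ := λ ∘ [·]` for a linear form `λ` on `r_N(ρ)` non-zero on some class (ℂ-vector spaces have enough functionals).
[cite: BernsteinZelevinsky1977, §1.8–1.9] -/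
theorem exists_functional_of_jacquetModule_eq_smul (ρ : Representation ℂ G V) (χ : t.M →* ℂˣ)
    [Nontrivial (t.restrict ρ).Coinvariants]
    (hT : ∀ (m : t.M) (x : (t.restrict ρ).Coinvariants), ρ.jacquetModule t m x = ((χ m : ℂˣ) : ℂ) • x) :
    ∃ ℓ : V →ₗ[ℂ] ℂ, ℓ ≠ 0 ∧ (∀ n : G, n ∈ t.N → ∀ v : V, ℓ (ρ n v) = ℓ v) ∧
      ∀ (m : t.M) (v : V), ℓ (ρ m v) = ((χ m : ℂˣ) : ℂ) * ℓ v := by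
  obtain ⟨x₀, hx₀⟩ := exists_ne (0 : (t.restrict ρ).Coinvariants)
  obtain ⟨φ, hφ⟩ := Module.Projective.exists_dual_ne_zero ℂ hx₀
  obtain ⟨v₀, hv₀⟩ := Representation.Coinvariants.mk_surjective (t.restrict ρ) x₀
  refine ⟨φ ∘ₗ Representation.Coinvariants.mk (t.restrict ρ), ?_, ?_, ?_⟩
  · intro h0
    apply hφ
    rw [← hv₀]
    exact LinearMap.congr_fun h0 v₀
  · intro n hn v
    rw [LinearMap.comp_apply, LinearMap.comp_apply]
    exact congrArg φ (Representation.Coinvariants.mk_self_apply (t.restrict ρ)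
      ⟨⟨n, t.N_le hn⟩, Subgroup.mem_subgroupOf.2 hn⟩ v)
  · intro m v
    rw [LinearMap.comp_apply, LinearMap.comp_apply, ← Representation.jacquetModule_mk ρ t m v, hT, map_smul, smul_eq_mul]

/-- **From the raw torus weight to the `δ^{1/2}`-currency at `p`.**  If `ℓ` is `N`-invariant and `M` acts through `χ`, and
`χ(m) = χ′(m) · δ_P^{1/2}(m)` on `M`, then `ℓ (ρ p v) = χ′(proj p) · δ_P^{1/2}(proj p) · ℓ v` for every `p ∈ P`
(★ `functional_proj_of_levi_unipotent`). [cite: BernsteinZelevinsky1977, §1.8, 1.7] -/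
theorem functional_proj_rootDeltaChar_of_levi [TopologicalSpace G] [IsTopologicalGroup G] [LocallyCompactSpace t.P]
    (ρ : Representation ℂ G V) (ℓ : V →ₗ[ℂ] ℂ) (χ χ' : t.M →* ℂˣ)
    (hN : ∀ n : G, n ∈ t.N → ∀ v : V, ℓ (ρ n v) = ℓ v)
    (hM : ∀ (m : t.M) (v : V), ℓ (ρ m v) = ((χ m : ℂˣ) : ℂ) * ℓ v)
    (hχ : ∀ m : t.M, ((χ m : ℂˣ) : ℂ) = ((χ' m : ℂˣ) : ℂ) * ((rootDeltaChar t.P ⟨(m : G), t.M_le m.2⟩ : ℂˣ) : ℂ))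
    (p : t.P) (v : V) :
    ℓ (ρ p v) = ((χ' (t.proj p) : ℂˣ) : ℂ) * ((rootDeltaChar t.P ⟨((t.proj p : t.M) : G), t.M_le (t.proj p).2⟩ : ℂˣ) : ℂ) * ℓ v := by
  -- the `M`-character `m ↦ χ′ m · δ^{1/2}(m)`
  let c : t.M →* ℂˣ := χ' * (rootDeltaChar t.P).comp (Subgroup.inclusion t.M_le)
  have hc : ∀ m : t.M, ((c m : ℂˣ) : ℂ) = ((χ' m : ℂˣ) : ℂ) * ((rootDeltaChar t.P ⟨(m : G), t.M_le m.2⟩ : ℂˣ) : ℂ) := fun m => by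
    rw [MonoidHom.mul_apply, Units.val_mul, MonoidHom.comp_apply]
    rfl
  rw [F0P2nJacquetFunctionalCurrency.functional_proj_of_levi_unipotent t ρ ℓ c hN (fun m v => by rw [hM, hχ, hc]) p v, hc]

end Generic

/-! ## §2 CM tokens: `χθ = χθʷ · ‖·‖` on the torus of `U(Φ₃)(L⁺_v)` -/

section CM

variable (L : Type) [Field L] [NumberField L] [IsCMField L]

/-- Commutative-group bookkeeping for `cmXiTorusChar_eq_weyl_mul_halfModulusChar_sq`: `A·B·C·D = A·(B·(C²)⁻¹)·C·D·C²`. [folklore] -/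
private theorem mul_weyl_aux {M : Type*} [CommGroup M] (A B C D : M) :
    A * B * C * D = A * (B * (C ^ 2)⁻¹) * C * D * C ^ 2 := by
  rw [show A * (B * (C ^ 2)⁻¹) * C * D * C ^ 2 = A * B * C * D * ((C ^ 2)⁻¹ * C ^ 2) by
    simp only [mul_assoc, mul_comm, mul_left_comm], inv_mul_cancel, mul_one]

set_option maxHeartbeats 1600000 in
/-- **`χθ(t) = χθʷ(t) · ‖t₀₀‖`**: `cmXiTorusChar L v μ η₁ η₂ t = cmXiTorusChar L v (μ·(‖·‖^{1/2})⁻²) η₁ η₂ t · (‖t₀₀‖^{1/2})²` — the `μ`-slot of ★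
`cmXiTorusChar` is multiplicative in `μ` (★ `xiTorusChar_apply`: `χ_ξ(t) = η₁(t₀₀/t̄₀₀)·μ(t₀₀)·‖t₀₀‖^{1/2}·η₂(det t)`).
[cite: Rogawski1990, §12.2 (2) p. 174] -/
theorem cmXiTorusChar_eq_weyl_mul_halfModulusChar_sq (v : HeightOneSpectrum (𝓞 ↥(maximalRealSubfield L)))
    (μ : (LocalRing L v)ˣ →* ℂˣ) (η₁ η₂ : ↥(normOneUnits (conjLocal L (IsCMField.complexConj L) v)) →* ℂˣ)
    (t : ↥(torusU (conjLocal L (IsCMField.complexConj L) v) (cmLocalForm L 3 v))) :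
    cmXiTorusChar L v μ η₁ η₂ t =
      cmXiTorusChar L v (μ * ((halfModulusChar (LocalRing L v)) ^ 2)⁻¹) η₁ η₂ t *
        (halfModulusChar (LocalRing L v) (torusEntry (conjLocal L (IsCMField.complexConj L) v) (cmLocalForm L 3 v) 0 t)) ^ 2 := by
  simp only [cmXiTorusChar, xiTorusChar_apply, MonoidHom.mul_apply, MonoidHom.inv_apply, MonoidHom.pow_apply]
  exact mul_weyl_aux _ _ _ _

end CM

/-! ## §3 Transport of the telescope: `κ_v⁻¹ ∘ localPiEquiv_H⁻¹ ∘ congr_T = localPiEquiv_{dV}⁻¹ ∘ congr_{g_v⁻¹ T}` -/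

section Transport

variable (L : Type) [Field L] [NumberField L] [IsCMField L]

/-- **The frame congruence at `v`**: from `ᵗḡ H g = diag dV` over `L`, `ᵗ(c̄⊗1)(g_v) · H_v · g_v = (diag dV)_v` over `∏_{w∣v} L_w`
(★ `formCongr_map`, ★ `algebraMap_localRing_conj`). [cite: PlatonovRapinchuk1994, §2.3] -/
theorem formCongr_toLocalGL_eq_diagonal {H : Matrix (Fin 3) (Fin 3) L} {dV : Fin 3 → L} {g : GL (Fin 3) L}
    (hg : ((g : Matrix (Fin 3) (Fin 3) L).map (cmConjRingHom L))ᵀ * H * (g : Matrix (Fin 3) (Fin 3) L) = Matrix.diagonal dV)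
    (v : HeightOneSpectrum (𝓞 ↥(maximalRealSubfield L))) :
    formCongr (conjLocal L (IsCMField.complexConj L) v) (toLocalGL L v g) (H.map (algebraMap L (LocalRing L v))) =
      (Matrix.diagonal dV).map (algebraMap L (LocalRing L v)) := by
  have hgL : formCongr ((IsCMField.complexConj L : L ≃ₐ[↥(maximalRealSubfield L)] L) : L →+* L) g H = Matrix.diagonal dV := hg
  rw [← hgL, formCongr_map _ (algebraMap L (LocalRing L v)) (algebraMap_localRing_conj L (IsCMField.complexConj L) v) g H]
  rfl

/-- **The transported form congruence**: if `ᵗT̄ H_v T = a·Φ₃` and `ᵗḡ H g = diag dV`, then `T′ := g_v⁻¹ T` satisfies `ᵗT̄′ (diag dV)_v T′ = a·Φ₃`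
(★ `formCongr_mul_eq`, ★ `formCongr_inv_formCongr`). [cite: PlatonovRapinchuk1994, §2.3] -/
theorem formCongr_inv_toLocalGL_mul_eq {H : Matrix (Fin 3) (Fin 3) L} {dV : Fin 3 → L} {g : GL (Fin 3) L}
    (hg : ((g : Matrix (Fin 3) (Fin 3) L).map (cmConjRingHom L))ᵀ * H * (g : Matrix (Fin 3) (Fin 3) L) = Matrix.diagonal dV)
    (v : HeightOneSpectrum (𝓞 ↥(maximalRealSubfield L))) (T : GL (Fin 3) (LocalRing L v)) {a : LocalRing L v}
    (h : formCongr (conjLocal L (IsCMField.complexConj L) v) T (H.map (algebraMap L (LocalRing L v))) =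
      a • (Matrix.of fun i j : Fin 3 => if i.val + j.val + 1 = 3 then (1 : L) else 0).map (algebraMap L (LocalRing L v))) :
    formCongr (conjLocal L (IsCMField.complexConj L) v) ((toLocalGL L v g)⁻¹ * T)
        ((Matrix.diagonal dV).map (algebraMap L (LocalRing L v))) =
      a • (Matrix.of fun i j : Fin 3 => if i.val + j.val + 1 = 3 then (1 : L) else 0).map (algebraMap L (LocalRing L v)) := by
  rw [formCongr_mul_eq, ← formCongr_toLocalGL_eq_diagonal L hg v, formCongr_inv_formCongr]
  exact h

set_option synthInstance.maxHeartbeats 400000 in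
set_option maxHeartbeats 8000000 in
/-- **The two pull-backs agree**: for `u ∈ U(Φ₃)(L⁺_v)`, `κ_v⁻¹ (localPiEquiv_H⁻¹ (T u T⁻¹)) = localPiEquiv_{dV}⁻¹ (T′ u T′⁻¹)` with `T′ = g_v⁻¹ T`
(`κ_v⁻¹ = g_v⁻¹ (·) g_v`, ★ `coe_localCongr_apply`; ★ `coe_cmDatumLocalCongr_apply`). [cite: PlatonovRapinchuk1994, §2.3] -/
theorem localCongr_symm_localPiEquiv_symm_cmDatumLocalCongr {H : Matrix (Fin 3) (Fin 3) L} {dV : Fin 3 → L} {g : GL (Fin 3) L}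
    (hg : ((g : Matrix (Fin 3) (Fin 3) L).map (cmConjRingHom L))ᵀ * H * (g : Matrix (Fin 3) (Fin 3) L) = Matrix.diagonal dV)
    (v : HeightOneSpectrum (𝓞 ↥(maximalRealSubfield L))) (T : GL (Fin 3) (LocalRing L v)) {a : LocalRing L v} (ha : IsUnit a)
    (h : formCongr (conjLocal L (IsCMField.complexConj L) v) T (H.map (algebraMap L (LocalRing L v))) =
      a • (Matrix.of fun i j : Fin 3 => if i.val + j.val + 1 = 3 then (1 : L) else 0).map (algebraMap L (LocalRing L v)))
    (u : Gqs L v) :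
    (localCongr L (IsCMField.complexConj L) g one_ne_zero (by rw [one_smul]; exact hg) v).symm
        ((localPiEquiv L (IsCMField.complexConj L) 3 H v).symm (cmDatumLocalCongr L v T ha h u)) =
      (localPiEquiv L (IsCMField.complexConj L) 3 (Matrix.diagonal dV) v).symm
        (cmDatumLocalCongr L v ((toLocalGL L v g)⁻¹ * T) ha (formCongr_inv_toLocalGL_mul_eq L hg v T h) u) := by
  rw [ContinuousMulEquiv.symm_apply_eq]
  refine Subtype.ext ?_
  rw [coe_localCongr_apply, coe_localPiEquiv_symm_apply, coe_localPiEquiv_symm_apply, coe_cmDatumLocalCongr_apply,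
    coe_cmDatumLocalCongr_apply, ← map_inv (localGLPiEquiv L 3 v), ← map_mul (localGLPiEquiv L 3 v),
    ← map_mul (localGLPiEquiv L 3 v)]
  congr 1
  simp only [mul_inv_rev, inv_inv, mul_assoc, mul_inv_cancel_left, mul_inv_cancel, mul_one]

end Transport

/-! ## §4 The head: N3 ⟹ N3ᵟ -/

set_option synthInstance.maxHeartbeats 400000 in
set_option maxHeartbeats 16000000 in
/-- **N3ᵟ FROM N3 (debt consolidation of the K1 line).**  Hypothesis: `hN3` = the raw print letter ★
`GelbartRogawski1991.thetaType_nonsplit_jacquetModule` ([GelbartRogawski1991 §3.2 (3.2.1)–(3.2.2) p. 457; Kudla1986 Thm. 2.8]: `r_N(X_v) ≃ ℱ_v[ψθ]`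
with the torus acting by `χθ = μ_v‖·‖^{1/2} ⊗ ψθ`).  Conclusion: ★ `GelbartRogawski1991.thetaType_nonsplit_borelEigenfunctional` VERBATIM — for every
`(ε, ψθ)` with `IsThetaCenterChar` and `OccursInLineWeilCM`, a NON-ZERO `(B, χθʷ·δ_B^{1/2})`-eigenfunctional on `X_v(μ, ε, χ_f)` read on `U(Φ₃)(L⁺_v)`
through `κ_v⁻¹ ∘ localPiEquiv_H⁻¹ ∘ congr_T`.  Proof = §1 (functional from the Jacquet module, non-zero because `ψθ` occurs) + §2 (`χθ = χθʷ·‖·‖`,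
`‖·‖ = δ_B^{1/2}` on the torus by ★ K1m `F0P2oBorelTorusModulus.rootDeltaChar_cmBorel_torus` — Mathlib's modular character of `B(L⁺_v)`,
[BernsteinZelevinsky1977 1.7] convention `map (· * g) μ = Δ(g) • μ` — and `p = m·n`) + §3 (transport `T′ = g_v⁻¹T`).  So the two GR91 local letters
N3, N3ᵟ count as ONE: N3ᵟ is a theorem modulo N3.
[cite: GelbartRogawski1991, §3.2 (3.2.1)–(3.2.2) p. 457; §1.4 pp. 450–451; §5.1 Lem. 5.1.2] [cite: Kudla1986, Thm. 2.8] [cite: BernsteinZelevinsky1977, §1.8, 1.7] -/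
theorem thetaType_nonsplit_borelEigenfunctional_of_jacquetModule
    (hN3 : Literature.NumberTheory.GelbartRogawski1991.thetaType_nonsplit_jacquetModule) :
    Literature.NumberTheory.GelbartRogawski1991.thetaType_nonsplit_borelEigenfunctional := by
  intro L _ _ _ H hH hHd n' e₁ dV hdV hdV0 g hg n₀ e₀ μ hμ χf hc hu v hv T a ha h ε ψθ hspec hocc
  haveI := locallyCompactSpace_cmBorelU L 3 v
  -- §3: the transported form congruence and the representation read along it (N3's carrier)
  have h' := formCongr_inv_toLocalGL_mul_eq L hg v T h
  obtain ⟨⟨e⟩, hTorus⟩ := hN3 L e₁ dV hdV hdV0 e₀ μ hμ χf hc hu v hv ε ψθ hspec ((toLocalGL L v g)⁻¹ * T) a ha h'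
  -- §1: `r_N(X_v) ≠ 0` because `ψθ` occurs, hence a non-zero `N`-invariant `(M, χθ)`-functional
  haveI : Nontrivial _ := Submodule.nontrivial_iff_ne_bot.2 hocc
  haveI : Nontrivial (((cmBorelTriple L 3 v).restrict
      (xThetaGqsCM L e₁ dV hdV hdV0 μ hμ χf ε v ((toLocalGL L v g)⁻¹ * T) ha h')).Coinvariants) := e.toEquiv.nontrivial
  obtain ⟨ℓ, hℓ0, hN, hM⟩ := exists_functional_of_jacquetModule_eq_smul (cmBorelTriple L 3 v)
    (xThetaGqsCM L e₁ dV hdV hdV0 μ hμ χf ε v ((toLocalGL L v g)⁻¹ * T) ha h')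
    (cmXiTorusChar L v ((toHeckeCharacter L μ).semilocalComponent L v) ψθ⁻¹ ψθ) hTorus
  -- §2: `χθ(m) = χθʷ(m) · δ^{1/2}(m)` on the torus
  have hχ : ∀ m : ↥(cmBorelTriple L 3 v).M,
      ((cmXiTorusChar L v ((toHeckeCharacter L μ).semilocalComponent L v) ψθ⁻¹ ψθ m : ℂˣ) : ℂ) =
        ((cmXiTorusChar L v ((toHeckeCharacter L μ).semilocalComponent L v * ((halfModulusChar (LocalRing L v)) ^ 2)⁻¹) ψθ⁻¹ ψθ m : ℂˣ) : ℂ) *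
          ((rootDeltaChar (cmBorelTriple L 3 v).P ⟨(m : ↥(unitaryGroupOfForm _ _)), (cmBorelTriple L 3 v).M_le m.2⟩ : ℂˣ) : ℂ) := by
    intro m
    rw [F0P2oBorelTorusModulus.rootDeltaChar_cmBorel_torus L v m, ← halfModulusChar_sq,
      cmXiTorusChar_eq_weyl_mul_halfModulusChar_sq L v _ ψθ⁻¹ ψθ m, Units.val_mul, Units.val_pow_eq_pow_val]
  refine ⟨ℓ, hℓ0, fun p w => ?_⟩
  -- §3: the two pull-backs of `X_v` to `U(Φ₃)(L⁺_v)` agree at `p` (definitional unfolding of the compositions + the lemma)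
  have hπ : (((xThetaCM L e₁ dV hdV hdV0 μ hμ χf ε v :
        localPi L (IsCMField.complexConj L) 3 (Matrix.diagonal dV) v →* _).comp
        (localCongr L (IsCMField.complexConj L) g one_ne_zero (by rw [one_smul]; exact hg) v).symm.toMulEquiv.toMonoidHom).comp
        ((cmDatumLocalCongr L v T ha h).trans
          (localPiEquiv L (IsCMField.complexConj L) 3 H v).symm).toMulEquiv.toMonoidHom) p.1 =
      xThetaGqsCM L e₁ dV hdV hdV0 μ hμ χf ε v ((toLocalGL L v g)⁻¹ * T) ha h' p.1 :=
    congrArg (xThetaCM L e₁ dV hdV hdV0 μ hμ χf ε v :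
        localPi L (IsCMField.complexConj L) 3 (Matrix.diagonal dV) v →* _)
      (localCongr_symm_localPiEquiv_symm_cmDatumLocalCongr L hg v T ha h p.1)
  calc _ = ℓ (xThetaGqsCM L e₁ dV hdV hdV0 μ hμ χf ε v ((toLocalGL L v g)⁻¹ * T) ha h' p.1 w) := by rw [hπ]
    _ = _ := functional_proj_rootDeltaChar_of_levi (cmBorelTriple L 3 v) _ ℓ _ _ hN hM hχ p w
    _ = _ := by rw [← F0P2nBorelCharactersUnipotent.rootDeltaChar_cmBorel_eq_proj L v p]

end Summit.HodgeConjecture.HodgeConjecture.Cruxes.H413.F0P2oBorelEigenfunctionalOfJacquetModule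

end
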